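import Mathlib.Probability.ProbabilityMassFunction.Constructions
import Mathlib.Probability.Distributions.Uniform
import Mathlib.Probability.Distributions.Poisson.Basic
import Mathlib.Analysis.SpecialFunctions.Pow.Real
import Mathlib.Analysis.SpecialFunctions.Log.Base
import Mathlib.Order.SymmDiff
import Mathlib.Data.Finset.Sort
import Mathlib.LinearAlgebra.UnitaryGroup
import Literature.Computability.Cryptography.FGComplexity
import Literature.Computability.Cryptography.QuantumCircuit
import Literature.Computability.Cryptography.SparseLPN
import HarnessLib

/-!
# Planted Noisy `k`XOR: the ensembles, the Kikuchi matrix, the distinguishing problem on the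
# word RAM, the Kikuchi-threshold hypothesis, and the quartic quantum speedup of
# Schmidhuber–O'Donnell–Kothari–Babbush (named fact)

Topic `Literature/Computability/QuantumComplexity`; definition request `defn-plantedNoisyKXOR`
(consumer: route QuantumAdvantage/ExponentLadder, crux KikuchiRung). Source: A. Schmidhuber,
R. O'Donnell, R. Kothari, R. Babbush, *Quartic quantum speedups for planted inference*,
Phys. Rev. X 15 (2025) 021077 = arXiv:2406.19378 (bib key `SchmidhuberEtAl2025`; "SOKB"), §2 and
§4, read from the materialised text.

## Contents (namespace `Literature.Computability.QuantumComplexity`, model namespace `KXOR`)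

Generic layer (average-case problems on the tree's word RAM, `Literature.Computability.Cryptography.WordRAM`):
* `avgSuccessProb μ enc good M k' t` — the `μ`-average over instances of the word-RAM success
  probability `WordRAM.successProb` (uniform coin words, word size `k' · inputWidth`, `t` steps);
* `DistFGProblem` — a distributional fine-grained problem (instance type, word encoding, one
  instance distribution per size `n`, accepted outputs), `successAt`, `RandSolvedFrom`, `RandInTimeO`;
* `QCircuitAlg Inst G` — a quantum algorithm for instances of type `Inst` in the circuit model of
  `QuantumCircuit.lean`: finitely many classical seed bits and, for each instance and seed, a
  circuit over the gate set `G` run on `|0…0⟩` whose wire `0` is measured (`outputOneProb`,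
  `avgOutputOne`, `avgOutputZero`); `twoLocal` — the gate set of ALL one- and two-qubit unitaries
  (SOKB count "arbitrary 1- and 2-qubit gates", footnote to Thm. 4.6);
* `circuitCode`, `writtenCircuit`, `transducerBornAvg` — a randomised word-RAM program WRITING the
  code of a circuit (uniform quantum algorithms with explicit classical preprocessing time).

Planted noisy `k`XOR (namespace `KXOR`, SOKB §2 in the `±1` notation of the paper):
* `Scope n k` (`k`-subsets of `Fin n`), `Instance n k` (lists of constraints `(S, b)`, Def. 2.1),
  `monomial x S = x^S`, `advantage` (Def. 2.2), `coeffB I S = B_I(S)` (Not. 2.24), `encode`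
  (word-RAM input, size parameter `n`);
* the ensembles `random n k m = 𝓡_{n,k}(m)` (Not. 2.3), `planted n k m ρ z = 𝓟^z_{n,k}(m,ρ)`
  (Not. 2.4), their Poissonisations `poissonRandom`, `poissonPlanted` (`m ∼ Poi(m̄)`), and the
  uniformly-random-`z` mixture `poissonPlantedAvg`;
* `kikuchiMatrix ℓ I = 𝓚_ℓ(I)` (Defs. 2.17–2.18: rows/columns `Scope n ℓ`, entry `B_I(T ∆ U)` when
  `|T ∆ U| = k`), `kikuchiDelta ℓ n k = δ_{ℓ,n,k}`, `lambdaMax` (Rayleigh supremum),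
  `aliceConstant k κ ε n = C_κ` and `thresholdDensity k ℓ κ n = C_κ · (n/ℓ)^{(k-2)/2}` (Thm. 2.21,
  with the admissible `ε := κ/(2+κ)`), `thresholdMean = Δ_ℓ · n` (the Poisson mean `m̄`);
* the DISTINGUISHING PROBLEM on the word RAM (Problem 2.6, two-sided, worst case over `z`, from
  some size on): `randomSuccess`, `plantedSuccess`, `DistinguishesFrom`, `RandDistinguishableInTimeO`,
  and the `DistFGProblem` renderings `randomProblem`, `plantedAvgProblem`;
* `KikuchiThreshold k ρ α` — the KIKUCHI-THRESHOLD HYPOTHESIS of the consumer route (OPEN; a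
  `Prop` definition, nothing asserted);
* `HasQuantumSolver`, `HasUniformQuantumSolver` — "a quantum algorithm with these gate/qubit
  (and preprocessing-time) bounds solves Problem 2.6 with probability `1 - o(1)`";
* NAMED FACT `SchmidhuberEtAl2025_thm418` — SOKB Thm. 4.18 (gate count) with the qubit count of
  §4 (Thms. 4.9, 4.15, 4.17), for every FIXED Kikuchi level `ℓ = ck`.

## Faithfulness notes and deliberate choices

* Labels follow Problem 2.6 verbatim: output `1` ("random") on `𝓡̃`, output `0` ("planted") on
  `𝓟̃^z`, for EVERY `z` (the paper remarks that the uniformly-random-`z` version has the same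
  complexity by a worst-case-to-average-case reduction over `z`; we also provide the mixture
  `poissonPlantedAvg` / `plantedAvgProblem` for consumers who want it, without asserting the
  equivalence).
* "`1 - o(1)`" is rendered as: for every `σ < 1` the success bound `σ` holds from some size `n₀`
  on. Fine-grained hypotheses use the fixed threshold `2/3` from some `n₀` on (for `n < k` the
  ensembles are degenerate point masses, so "for all `n`" would be unsatisfiable).
* Word-RAM conventions are the tree's (`FGComplexity.lean`): oracle-free programs, word size
  `k' · inputWidth (encode I)` (`= Θ(log n)` bits here), time `⌊C · t(n) + C⌋₊`, success probability
  over uniform coin words (`WordRAM.successProb`), averaged over the instance (`avgSuccessProb`).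
* Thm. 4.18 is printed for "constants `k`, `ρ`", a "reasonable Alice Theorem (e.g. Thm. 2.21)" at
  `κ = 0.99ρ`, and `ℓ = ck = O(√n)`; the named fact instantiates the Alice Theorem with the
  paper's own Thm. 2.21 (admissible `ε = κ/(2+κ)`), takes the density EXACTLY at that threshold,
  and FIXES `ℓ` (so `ℓ^{O(ℓ)}` and `log^{ℓ/2k} n` are absorbed into `C · (log n)^a`) — a special case
  of the printed statement. Gate complexity counts arbitrary one- and two-qubit gates (`twoLocal`),
  as in the paper. The QUBIT bound is the one the paper prints: `A + O(N) + Õ(log Q)` (Thm. 4.9)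
  with `N = O(ℓ log n)` (§4.4, Thm. 4.17), i.e. `Õ(ℓ log n)` — NOT `O(ℓ log n)`: the extra
  `polylog(ℓ log n)` factor is kept (`(log₂(ℓ log₂ n))^a`), with constants uniform in `ℓ` (the
  paper lets `ℓ` grow with `n`).
* NOT vendored as facts (deliberately): uniformity / classical preprocessing time of the quantum
  algorithm (the paper says "efficient"; a consumer needing an explicit bound states it with
  `HasUniformQuantumSolver` and proves it from §4), the Alice Theorem 2.21 itself, Prop. 2.30,
  Thm. 2.40 (all provable in principle; none is needed to STATE the items of the consumer route).
* Junk values (documented at the definitions): ensembles are the point mass on the empty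
  instance when `n < k`; `advantage` of the empty instance is `0`; `lambdaMax` over an empty
  index type is `0`; `kikuchiDelta` uses truncated subtraction (exact for `n ≥ k`, `ℓ ≥ k/2`).

## References

* A. Schmidhuber, R. O'Donnell, R. Kothari, R. Babbush, PRX 15 (2025) 021077, arXiv:2406.19378:
  Defs. 2.1–2.2, Not. 2.3–2.4, Problem 2.6, Defs. 2.17–2.18, Not. 2.24, Thm. 2.21, Thms. 4.9,
  4.15, 4.17, 4.18, footnote to Thm. 4.6 (gate counts), §1.1 (computational threshold).
* A. S. Wein, A. El Alaoui, C. Moore, *The Kikuchi hierarchy and tensor PCA*, FOCS 2019 (the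
  Kikuchi method; bib `WeinElalaouiMoore2019`); M. B. Hastings, Quantum 4 (2020) 237 (`Hastings2020`).
* P. Kothari, R. Mori, R. O'Donnell, D. Witmer, STOC 2017 (`KothariEtAl2017`: SoS lower bounds,
  the evidence for Kikuchi optimality up to polylogarithmic factors in the density).
* V. Vassilevska Williams, ICM 2018, §2 (word RAM, randomised fine-grained algorithms; `ICM2018`).
-/

noncomputable section

open scoped NNReal symmDiff
open ProbabilityTheory Matrix

namespace Literature.Computability.QuantumComplexity

open Cryptography WordRAM

/-! ## Average-case success probability on the word RAM -/

/-- `avgSuccessProb μ enc good M k' t`: the probability, over an instance `a ∼ μ` AND the uniform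
coin words of the oracle-free word-RAM program `M` (word size `k' · inputWidth (enc a)`), that `M`
run on `enc a` halts within `t` steps with an output in `good a`:
`∑' a, μ(a) · successProb M (k'·width) noOracle (enc a) (good a) t`. The average-case version of
the success probability of `FGProblem.RandInTimeInst` (VVW ICM 2018, §2), as used for
distributional problems such as SOKB Problem 2.6 ("probability over the randomness in the input
and the internal randomness of the algorithm", §1.1). [cite: SchmidhuberEtAl2025, §1.1 and Problem 2.6] -/
def avgSuccessProb {ι : Type*} (μ : PMF ι) (enc : ι → List ℕ) (good : ι → Set (List ℕ))
    (M : Program) (k' t : ℕ) : ℝ :=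
  ∑' a, (μ a).toReal * successProb M (k' * inputWidth (enc a)) noOracle (enc a) (good a) t

section avg

variable {ι : Type*} (μ : PMF ι) (enc : ι → List ℕ) (good : ι → Set (List ℕ)) (M : Program)
  (k' t : ℕ)

/-- The average success probability is nonnegative. [folklore] -/
theorem avgSuccessProb_nonneg : 0 ≤ avgSuccessProb μ enc good M k' t :=
  tsum_nonneg fun _ => mul_nonneg ENNReal.toReal_nonneg (successProb_nonneg _ _ _ _ _ _)

/-- The average success probability is at most `1` (the weights `μ a` sum to `1` and each
success probability is at most `1`). [folklore] -/
theorem avgSuccessProb_le_one : avgSuccessProb μ enc good M k' t ≤ 1 := by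
  unfold avgSuccessProb
  have hne : ∀ a, μ a ≠ ⊤ := fun a => PMF.apply_ne_top μ a
  have hsum : Summable fun a => (μ a).toReal :=
    ENNReal.summable_toReal (by rw [μ.tsum_coe]; exact ENNReal.one_ne_top)
  have h0 : ∀ a, 0 ≤ (μ a).toReal *
      successProb M (k' * inputWidth (enc a)) noOracle (enc a) (good a) t :=
    fun a => mul_nonneg ENNReal.toReal_nonneg (successProb_nonneg _ _ _ _ _ _)
  have h1 : ∀ a, (μ a).toReal *
      successProb M (k' * inputWidth (enc a)) noOracle (enc a) (good a) t ≤ (μ a).toReal :=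
    fun a => mul_le_of_le_one_right ENNReal.toReal_nonneg (successProb_le_one _ _ _ _ _ _)
  calc ∑' a, (μ a).toReal * successProb M (k' * inputWidth (enc a)) noOracle (enc a) (good a) t
      ≤ ∑' a, (μ a).toReal := (hsum.of_nonneg_of_le h0 h1).tsum_le_tsum h1 hsum
    _ = (∑' a, μ a).toReal := (ENNReal.tsum_toReal_eq hne).symm
    _ = 1 := by rw [μ.tsum_coe, ENNReal.toReal_one]

end avg

/-! ## Distributional fine-grained problems -/

/-- A DISTRIBUTIONAL (average-case) fine-grained problem on the word RAM: an instance type, the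
word encoding of instances, for each size parameter `n` a distribution `dist n` on instances, and
the accepted outputs. The average-case companion of the tree's `FGProblem` (VVW ICM 2018, §2),
in the shape of SOKB Problem 2.6 (an input distribution indexed by `n`). [cite: SchmidhuberEtAl2025, Problem 2.6 (shape); VVW ICM2018 §2 (word RAM)] -/
structure DistFGProblem where
  /-- The type of instances (all sizes). -/
  Inst : Type
  /-- The encoding of an instance as the word-RAM input. -/
  encode : Inst → List ℕ
  /-- The instance distribution at size parameter `n`. -/
  dist : ℕ → PMF Inst
  /-- The set of accepted outputs on an instance. -/
  Good : Inst → Set (List ℕ)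

namespace DistFGProblem

/-- `P.successAt M k' t n`: the probability over `a ∼ P.dist n` and the coins of `M` that `M`
outputs an accepted answer within `t` steps. [folklore] -/
def successAt (P : DistFGProblem) (M : Program) (k' t n : ℕ) : ℝ :=
  avgSuccessProb (P.dist n) P.encode P.Good M k' t

/-- `P.RandSolvedFrom M k' T σ n₀`: the oracle-free program `M` (word-size factor `k'`) solves `P`
with probability at least `σ` within `T n` steps at every size `n ≥ n₀`. [folklore] -/
def RandSolvedFrom (P : DistFGProblem) (M : Program) (k' : ℕ) (T : ℕ → ℕ) (σ : ℝ) (n₀ : ℕ) :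
    Prop :=
  M.IsOracleFree ∧ ∀ n, n₀ ≤ n → σ ≤ P.successAt M k' (T n) n

/-- `P.RandInTimeO t σ`: some randomised word-RAM program solves `P` with probability `≥ σ` in
time `O(t(n))` (i.e. `⌊C · t n + C⌋₊` steps, the tree's convention of `FGProblem.RandInTimeO`) from
some size on. [folklore] -/
def RandInTimeO (P : DistFGProblem) (t : ℕ → ℝ) (σ : ℝ) : Prop :=
  ∃ (M : Program) (k' n₀ : ℕ) (C : ℝ), P.RandSolvedFrom M k' (fun n => ⌊C * t n + C⌋₊) σ n₀

/-- Success probabilities of a distributional problem lie in `[0, 1]`: lower bound. [folklore] -/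
theorem successAt_nonneg (P : DistFGProblem) (M : Program) (k' t n : ℕ) :
    0 ≤ P.successAt M k' t n :=
  avgSuccessProb_nonneg _ _ _ _ _ _

/-- Success probabilities of a distributional problem lie in `[0, 1]`: upper bound. [folklore] -/
theorem successAt_le_one (P : DistFGProblem) (M : Program) (k' t n : ℕ) :
    P.successAt M k' t n ≤ 1 :=
  avgSuccessProb_le_one _ _ _ _ _ _

/-- Nothing is solved with probability exceeding `1`. [folklore] -/
theorem not_randSolvedFrom_of_one_lt (P : DistFGProblem) (M : Program) (k' : ℕ) (T : ℕ → ℕ)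
    {σ : ℝ} (hσ : 1 < σ) (n₀ : ℕ) : ¬ P.RandSolvedFrom M k' T σ n₀ :=
  fun h => (lt_of_le_of_lt (P.successAt_le_one M k' (T n₀) n₀) hσ).not_ge (h.2 n₀ le_rfl)

end DistFGProblem

/-! ## Quantum algorithms for instances, in the circuit model of `QuantumCircuit.lean` -/

/-- The gate set of ALL one- and two-qubit unitary gates (symbols: the unitary groups of
`QReg 1` and `QReg 2`; each symbol denotes itself). SOKB measure "gate complexity" as "the total
number of (arbitrary) 1- and 2-qubit gates used by the quantum algorithm" (footnote to Thm. 4.6),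
adding that a finite universal gate set costs a logarithmic overhead.
[cite: SchmidhuberEtAl2025, §4.1, footnote to Thm. 4.6] -/
def twoLocal : QGateSet where
  Op := Matrix.unitaryGroup (QReg 1) ℂ ⊕ Matrix.unitaryGroup (QReg 2) ℂ
  arity g := Sum.elim (fun _ => 1) (fun _ => 2) g
  mat g := match g with
    | .inl U => (U : Matrix (QReg 1) (QReg 1) ℂ)
    | .inr U => (U : Matrix (QReg 2) (QReg 2) ℂ)

/-- Every gate of `twoLocal` is unitary. [folklore] -/
theorem twoLocal_isUnitary : twoLocal.IsUnitary := by
  rintro (U | U)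
  · exact U.2
  · exact U.2

/-- A QUANTUM ALGORITHM for instances of type `Inst` over the gate set `G`, in the circuit model:
`seeds` classical coin bits (the algorithm's classical internal randomness, e.g. SOKB's random
split of the constraints into `𝓘 ⊔ 𝓘_guide`, Thm. 2.40/4.18), and for each instance `a` and seed
`r` a circuit `circ a r` on `width a r` qubits, run on `|0…0⟩`, after which wire `0` is measured
and reported. (Nielsen–Chuang §4.5 circuit model as in `QuantumCircuit.lean`; instance-dependent
circuits as in SOKB Thm. 4.15: "an efficient algorithm that takes as input 𝓘 and produces a
quantum circuit".) [cite: SchmidhuberEtAl2025, Thm. 4.15 and §4.4 (instance-dependent circuits)] -/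
structure QCircuitAlg (Inst : Type) (G : QGateSet) where
  /-- The number of classical seed (coin) bits. -/
  seeds : ℕ
  /-- The number of qubits of the circuit built for instance `a` and seed `r`. -/
  width : Inst → (Fin seeds → Bool) → ℕ
  /-- The circuit built for instance `a` and seed `r`, to be run on `|0…0⟩`. -/
  circ : (a : Inst) → (r : Fin seeds → Bool) → QCircuit G (width a r)

namespace QCircuitAlg

variable {Inst : Type} {G : QGateSet}

/-- The Born probability that wire `0` reads `1` after running `circ a r` on `|0…0⟩` (oracle-free
semantics: the empty oracle language `0`). [folklore] -/
def outputOneProb (A : QCircuitAlg Inst G) (a : Inst) (r : Fin A.seeds → Bool) : ℝ :=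
  (A.circ a r).probEvent 0 (basisState fun _ => false) (QCircuit.acceptEvent (A.width a r))

/-- The Born probability that wire `0` reads `0` (the complementary event). [folklore] -/
def outputZeroProb (A : QCircuitAlg Inst G) (a : Inst) (r : Fin A.seeds → Bool) : ℝ :=
  (A.circ a r).probEvent 0 (basisState fun _ => false) (QCircuit.acceptEvent (A.width a r))ᶜ

/-- The probability of reporting `1`, over an instance `a ∼ μ`, a uniform seed and the final
measurement: `∑' a, μ(a) · 2^{-seeds} ∑_r Pr[wire 0 = 1]`. [folklore] -/
def avgOutputOne (A : QCircuitAlg Inst G) (μ : PMF Inst) : ℝ :=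
  ∑' a, (μ a).toReal * ((∑ r, A.outputOneProb a r) / 2 ^ A.seeds)

/-- The probability of reporting `0`, over an instance `a ∼ μ`, a uniform seed and the final
measurement. [folklore] -/
def avgOutputZero (A : QCircuitAlg Inst G) (μ : PMF Inst) : ℝ :=
  ∑' a, (μ a).toReal * ((∑ r, A.outputZeroProb a r) / 2 ^ A.seeds)

/-- Output probabilities are nonnegative. [folklore] -/
theorem outputOneProb_nonneg (A : QCircuitAlg Inst G) (a : Inst) (r : Fin A.seeds → Bool) :
    0 ≤ A.outputOneProb a r :=
  QCircuit.probEvent_nonneg _ _ _ _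

/-- Averaged output probabilities are nonnegative. [folklore] -/
theorem avgOutputOne_nonneg (A : QCircuitAlg Inst G) (μ : PMF Inst) : 0 ≤ A.avgOutputOne μ :=
  tsum_nonneg fun a => mul_nonneg ENNReal.toReal_nonneg
    (div_nonneg (Finset.sum_nonneg fun r _ => A.outputOneProb_nonneg a r) (by positivity))

end QCircuitAlg

/-! ## Uniform quantum algorithms: a word-RAM program writing the circuit -/

section uniform

variable {G : QGateSet} [Encodable G.Op]

/-- The word-list code of a circuit `C` on `q` wires over an encodable gate set: the word `q`
followed by the bits of the tree's raw circuit encoder `QCircuit.encode C` as `0/1` words.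
[folklore] -/
def circuitCode (C : Σ q, QCircuit G q) : List ℕ :=
  C.1 :: C.2.encode.map Bool.toNat

/-- `circuitCode` is injective (from `QCircuit.encode_injective`). [folklore] -/
theorem circuitCode_injective : Function.Injective (circuitCode (G := G)) := by
  rintro ⟨q, C⟩ ⟨q', C'⟩ h
  simp only [circuitCode, List.cons.injEq] at h
  obtain ⟨rfl, h2⟩ := h
  have hb : Function.Injective Bool.toNat := fun a b hab => by
    cases a <;> cases b <;> simp_all [Bool.toNat]
  have : C.encode = C'.encode := (List.map_injective_iff.2 hb) h2
  rw [QCircuit.encode_injective this]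

variable (G)

/-- The circuit WRITTEN by a run: `some C` if the word-RAM program `W` (word size `w`, coin stream
`ρ`) run on `x` outputs `circuitCode C` within `t` steps, `none` if it outputs no circuit code in
time (a run has at most one output and codes are injective, so `C` is then unique). [folklore] -/
def writtenCircuit (W : Program) (w : ℕ) (ρ : ℕ → ℕ) (x : List ℕ) (t : ℕ) :
    Option (Σ q, QCircuit G q) :=
  open scoped Classical in
  if h : ∃ C : Σ q, QCircuit G q, OutputsWithin W w noOracle ρ x (circuitCode C) t then
    some (Classical.choose h) else none

/-- The Born probability that wire `0` of the circuit `C` run on `|0…0⟩` reads `one`. [folklore] -/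
def wireZeroProb (C : Σ q, QCircuit G q) (one : Bool) : ℝ :=
  C.2.probEvent 0 (basisState fun _ => false)
    (if one then QCircuit.acceptEvent C.1 else (QCircuit.acceptEvent C.1)ᶜ)

/-- `transducerBornAvg G μ enc W k' t one`: the probability, over an instance `a ∼ μ`, uniform coin
words of `W` (word size `k' · inputWidth (enc a)`, `t` steps) and the final measurement, that `W`
writes a circuit within `t` steps AND wire `0` of that circuit, run on `|0…0⟩`, reads `one`. [folklore] -/
def transducerBornAvg {ι : Type*} (μ : PMF ι) (enc : ι → List ℕ) (W : Program) (k' t : ℕ)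
    (one : Bool) : ℝ :=
  ∑' a, (μ a).toReal *
    ((∑ ρ : Fin t → Fin (2 ^ (k' * inputWidth (enc a))),
        match writtenCircuit G W (k' * inputWidth (enc a)) (coinStream ρ) (enc a) t with
        | some C => wireZeroProb G C one
        | none => 0) /
      ((2 : ℝ) ^ (k' * inputWidth (enc a))) ^ t)

end uniform

/-! ## Planted noisy `k`XOR (SOKB §2) -/

namespace KXOR

/-- A SCOPE: a subset of the variable set `[n] = Fin n` of cardinality exactly `k` (an element of
`([n] choose k)`). [cite: SchmidhuberEtAl2025, Def. 2.1] -/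
abbrev Scope (n k : ℕ) : Type := {S : Finset (Fin n) // S.card = k}

/-- Scopes exist iff `k ≤ n`. [folklore] -/
theorem nonempty_scope_iff (n k : ℕ) : Nonempty (Scope n k) ↔ k ≤ n := by
  constructor
  · rintro ⟨S, hS⟩
    rw [← hS]
    exact (Finset.card_le_univ S).trans_eq (Fintype.card_fin n)
  · intro h
    obtain ⟨S, -, hS⟩ := Finset.exists_subset_card_eq (s := (Finset.univ : Finset (Fin n)))
      (n := k) (by simpa using h)
    exact ⟨⟨S, hS⟩⟩

/-- A `k`XOR INSTANCE over the variables `[n]`: a finite multiset — here a list — of constraints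
`(S, b)` with a scope `S` of cardinality `k` and a right-hand side `b ∈ {±1}` (`ℤˣ`), read as the
equation `x^S = b`. [cite: SchmidhuberEtAl2025, Def. 2.1] -/
abbrev Instance (n k : ℕ) : Type := List (Scope n k × ℤˣ)

variable {n k : ℕ}

/-- The monomial `x^S = ∏_{i ∈ S} xᵢ ∈ {±1}` of an assignment `x ∈ {±1}ⁿ`. [cite: SchmidhuberEtAl2025, Def. 2.2] -/
def monomial (x : Fin n → ℤˣ) (S : Finset (Fin n)) : ℤˣ :=
  ∏ i ∈ S, x i

/-- The ADVANTAGE `adv_𝓘(x) = avg_{(S,b) ∈ 𝓘} b · x^S ∈ [-1, 1]` of the assignment `x` (so that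
`½ + ½ adv` is the fraction of satisfied constraints). Junk value `0` on the empty instance.
[cite: SchmidhuberEtAl2025, Def. 2.2] -/
def advantage (I : Instance n k) (x : Fin n → ℤˣ) : ℝ :=
  ((I.map fun c => ((c.2 * monomial x c.1.1 : ℤˣ) : ℤ)).sum : ℝ) / I.length

/-- `B_𝓘(S) = ∑_{(S,b) ∈ 𝓘} b`, the net right-hand side on the scope `S` (the coefficient of `X^S` in
the degree-`k` polynomial of `𝓘`). [cite: SchmidhuberEtAl2025, Notation 2.24] -/
def coeffB (I : Instance n k) (S : Scope n k) : ℤ :=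
  ((I.filter fun c => c.1 = S).map fun c => ((c.2 : ℤˣ) : ℤ)).sum

/-- The empty instance has all coefficients `0`. [folklore] -/
@[simp] theorem coeffB_nil (S : Scope n k) : coeffB ([] : Instance n k) S = 0 := rfl

/-! ### Word encoding (the word-RAM input) -/

/-- The words of one constraint `(S, b)`: the `k` elements of `S` in increasing order, then the
bit `0` for `b = +1` / `1` for `b = -1`. [folklore] -/
def encodeConstraint (c : Scope n k × ℤˣ) : List ℕ :=
  (c.1.1.sort (· ≤ ·)).map Fin.val ++ [if c.2 = 1 then 0 else 1]

/-- The word-RAM encoding of an instance: the words `n`, `k`, then the constraints one after the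
other (`encodeConstraint`). All entries are `≤ max n k 1`, so with the size parameter `n` the
tree's word size `k' · inputWidth` is `Θ(log n + log |𝓘|)` bits. [folklore] -/
def encode (I : Instance n k) : List ℕ :=
  n :: k :: I.flatMap encodeConstraint

/-- One constraint occupies `k + 1` words. [folklore] -/
@[simp] theorem length_encodeConstraint (c : Scope n k × ℤˣ) :
    (encodeConstraint c).length = k + 1 := by
  simp [encodeConstraint, Finset.length_sort, c.1.2]

/-- The constraint block of the encoding has `(k + 1) · |𝓘|` words. [folklore] -/
theorem length_flatMap_encodeConstraint (I : Instance n k) :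
    (I.flatMap encodeConstraint).length = (k + 1) * I.length := by
  induction I with
  | nil => simp
  | cons c I ih => rw [List.flatMap_cons, List.length_append, ih, length_encodeConstraint,
      List.length_cons]; ring

/-- The encoding of an instance with `m` constraints has `(k + 1) · m + 2` words. [folklore] -/
theorem length_encode (I : Instance n k) : (encode I).length = (k + 1) * I.length + 2 := by
  rw [encode, List.length_cons, List.length_cons, length_flatMap_encodeConstraint]

/-! ### The random and planted ensembles -/

/-- A Rademacher sign: uniform on `{±1}`. [cite: SchmidhuberEtAl2025, Notation 2.3] -/
def rademacher : PMF ℤˣ :=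
  PMF.uniformOfFintype ℤˣ

/-- The noise sign `η` with `𝔼 η = ρ`: `-1` with probability the noise rate `½ - ½ρ` (clamped to
`[0, 1]`; the tree's Bernoulli bit `bernoulliBit` of `SparseLPN.lean`), else `+1`; `ρ = 1 - 2η` is
the "planted advantage". [cite: SchmidhuberEtAl2025, Notation 2.4 and §1.1 (ρ = 1 - 2η)] -/
def biasedSign (ρ : ℝ) : PMF ℤˣ :=
  (bernoulliBit ((1 - ρ) / 2)).map fun b => if b = 1 then -1 else 1

/-- One uniformly random constraint: a uniform scope with an independent Rademacher right-hand
side (uniform on `Scope n k × {±1}`); needs `k ≤ n`. [cite: SchmidhuberEtAl2025, Notation 2.3] -/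
def uniformConstraint (n k : ℕ) (h : k ≤ n) : PMF (Scope n k × ℤˣ) :=
  haveI : Nonempty (Scope n k) := (nonempty_scope_iff n k).2 h
  PMF.uniformOfFintype (Scope n k × ℤˣ)

/-- One planted noisy constraint for the secret `z ∈ {±1}ⁿ`: a uniform scope `S` with right-hand
side `η · z^S`, `η ∼ biasedSign ρ` independent; needs `k ≤ n`. [cite: SchmidhuberEtAl2025, Notation 2.4] -/
def plantedConstraint (n k : ℕ) (h : k ≤ n) (ρ : ℝ) (z : Fin n → ℤˣ) : PMF (Scope n k × ℤˣ) :=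
  haveI : Nonempty (Scope n k) := (nonempty_scope_iff n k).2 h
  (PMF.uniformOfFintype (Scope n k)).bind fun S => (biasedSign ρ).map fun η => (S, η * monomial z S.1)

/-- `𝓡_{n,k}(m)`: `m` independent uniformly random constraints (uniform scopes, Rademacher
right-hand sides), as a list. Junk: the point mass on the empty instance when `n < k`.
[cite: SchmidhuberEtAl2025, Notation 2.3] -/
def random (n k m : ℕ) : PMF (Instance n k) :=
  if h : k ≤ n then (iidPMF (ι := Fin m) (uniformConstraint n k h)).map List.ofFn else PMF.pure []

/-- `𝓟^z_{n,k}(m, ρ)`: `m` independent planted noisy constraints for the secret `z` with planted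
advantage `ρ` (right-hand sides `ηᵢ z^{Sᵢ}`, `𝔼 ηᵢ = ρ`). Junk: point mass on `[]` when `n < k`.
[cite: SchmidhuberEtAl2025, Notation 2.4] -/
def planted (n k m : ℕ) (ρ : ℝ) (z : Fin n → ℤˣ) : PMF (Instance n k) :=
  if h : k ≤ n then (iidPMF (ι := Fin m) (plantedConstraint n k h ρ z)).map List.ofFn
  else PMF.pure []

/-- `𝓡̃_{n,k}(m̄)`, the POISSONISED random ensemble: draw `m ∼ Poi(m̄)` (Mathlib's `poissonMeasure`),
then `𝓡_{n,k}(m)`. [cite: SchmidhuberEtAl2025, Notation 2.3] -/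
def poissonRandom (n k : ℕ) (m : ℝ≥0) : PMF (Instance n k) :=
  (poissonMeasure m).toPMF.bind fun m' => random n k m'

/-- `𝓟̃^z_{n,k}(m̄, ρ)`, the POISSONISED planted ensemble: `m ∼ Poi(m̄)`, then `𝓟^z_{n,k}(m, ρ)`.
[cite: SchmidhuberEtAl2025, Notation 2.4] -/
def poissonPlanted (n k : ℕ) (m : ℝ≥0) (ρ : ℝ) (z : Fin n → ℤˣ) : PMF (Instance n k) :=
  (poissonMeasure m).toPMF.bind fun m' => planted n k m' ρ z

/-- The Poissonised planted ensemble with a UNIFORMLY RANDOM hidden secret `z` (the variant the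
paper calls "slightly easier" but of the same complexity by a worst-case-to-average-case reduction
over `z`, remark after Problem 2.6). [cite: SchmidhuberEtAl2025, §2.1 (remark after Problem 2.6)] -/
def poissonPlantedAvg (n k : ℕ) (m : ℝ≥0) (ρ : ℝ) : PMF (Instance n k) :=
  (PMF.uniformOfFintype (Fin n → ℤˣ)).bind fun z => poissonPlanted n k m ρ z

/-! ### The Kikuchi matrix, its density parameter, and the Alice threshold -/

/-- The level-`ℓ` KIKUCHI MATRIX `𝓚_ℓ(𝓘)` of a `k`XOR instance: rows and columns indexed by
`([n] choose ℓ)`, entry `(T, U) = B_𝓘(T ∆ U)` when `|T ∆ U| = k` and `0` otherwise — the signed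
adjacency matrix of the `ℓ`-Kikuchi graph, in which `T`, `U` are joined by the constraint `(S, b)`
iff `T ∆ U = S` (each constraint contributes the signed Kikuchi matching `b · K_S^{ℓ,n,k}`).
Intended regime `k` even, `n ≥ ℓ ≥ k/2` (for odd `k` the matrix is `0`). [cite: SchmidhuberEtAl2025, Defs. 2.17–2.18 with Def. 2.11 and Not. 2.24] -/
def kikuchiMatrix (ℓ : ℕ) (I : Instance n k) : Matrix (Scope n ℓ) (Scope n ℓ) ℝ :=
  Matrix.of fun T U => if h : (T.1 ∆ U.1).card = k then (coeffB I ⟨T.1 ∆ U.1, h⟩ : ℝ) else 0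

/-- Entries of the Kikuchi matrix. [cite: SchmidhuberEtAl2025, Def. 2.18] -/
theorem kikuchiMatrix_apply (ℓ : ℕ) (I : Instance n k) (T U : Scope n ℓ) :
    kikuchiMatrix ℓ I T U =
      if h : (T.1 ∆ U.1).card = k then (coeffB I ⟨T.1 ∆ U.1, h⟩ : ℝ) else 0 := rfl

/-- The Kikuchi matrix is symmetric (`T ∆ U = U ∆ T`). [cite: SchmidhuberEtAl2025, Def. 2.11 ("symmetric adjacency matrix")] -/
theorem kikuchiMatrix_isSymm (ℓ : ℕ) (I : Instance n k) : (kikuchiMatrix ℓ I).IsSymm := by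
  refine Matrix.IsSymm.ext fun T U => ?_
  simp only [kikuchiMatrix_apply]
  rw [symmDiff_comm]

/-- The Kikuchi matrix has zero diagonal when `k ≠ 0` (`T ∆ T = ∅` is not a scope). [folklore] -/
theorem kikuchiMatrix_apply_self (hk : k ≠ 0) (ℓ : ℕ) (I : Instance n k) (T : Scope n ℓ) :
    kikuchiMatrix ℓ I T T = 0 := by
  rw [kikuchiMatrix_apply, dif_neg]
  rw [symmDiff_self, Finset.bot_eq_empty, Finset.card_empty]
  exact fun h => hk h.symm

/-- The Kikuchi matrix of the empty instance vanishes. [folklore] -/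
@[simp] theorem kikuchiMatrix_nil (ℓ : ℕ) : kikuchiMatrix ℓ ([] : Instance n k) = 0 := by
  ext T U
  rw [kikuchiMatrix_apply]
  split_ifs <;> simp

/-- `δ_{ℓ,n,k} = (k choose k/2) · (n-k choose ℓ-k/2) / (n choose ℓ)`: the fraction of the `ℓ`-sets
touched by one Kikuchi matching, so that the average degree of `𝓚_ℓ(𝓘)` for `|𝓘| = m` is
`d = δ_{ℓ,n,k} · m`. Truncated subtractions; exact in the paper's regime `k` even, `n ≥ ℓ ≥ k/2`.
[cite: SchmidhuberEtAl2025, Def. 2.17 (eq. for δ_{ℓ,n,k})] -/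
def kikuchiDelta (ℓ n k : ℕ) : ℝ :=
  (k.choose (k / 2) : ℝ) * ((n - k).choose (ℓ - k / 2) : ℝ) / (n.choose ℓ : ℝ)

/-- The largest eigenvalue of a real symmetric matrix as the supremum of its Rayleigh quotients
`λ_max(A) = sup_{v ≠ 0} ⟨v, A v⟩ / ⟨v, v⟩` (the quantity thresholded by the Kikuchi method and by
SOKB's quantum algorithm). Junk value `0` for an empty index type. [cite: SchmidhuberEtAl2025, §1.2 eq. (1) and Fact 2.10] -/
def lambdaMax {ι : Type*} [Fintype ι] (A : Matrix ι ι ℝ) : ℝ :=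
  ⨆ v : {v : ι → ℝ // v ≠ 0}, (v.1 ⬝ᵥ A *ᵥ v.1) / (v.1 ⬝ᵥ v.1)

/-- The Alice constant `C_κ = (2(1+ε)(1+κ)/κ²) · (k choose k/2)⁻¹ · ln n` of SOKB's explicit
"Alice Theorem" 2.21 (matrix Chernoff): for `Δ = m/n ≥ C_κ · (n/ℓ)^{(k-2)/2}`, `κ ≤ 1` and
`0 < ε ≤ κ/(2+κ)`, a draw from `𝓡_{n,k}(m)` or `𝓡̃_{n,k}(m)` has `λ_max(𝓚_ℓ) ≤ κ · δ_{ℓ,n,k} · m`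
except with probability `≤ 3 n^{-εℓ}`. [cite: SchmidhuberEtAl2025, Thm. 2.21 (ineq. for C_κ)] -/
def aliceConstant (k : ℕ) (κ ε : ℝ) (n : ℕ) : ℝ :=
  2 * (1 + ε) * (1 + κ) / κ ^ 2 * ((k.choose (k / 2) : ℝ))⁻¹ * Real.log n

/-- The KIKUCHI THRESHOLD DENSITY at level `ℓ`: `Δ_ℓ(n) = C_κ · (n/ℓ)^{(k-2)/2}` with the Alice
constant of Thm. 2.21 at the admissible choice `ε = κ/(2+κ)` — the constraint density from which
the level-`ℓ` Kikuchi method (time `Õ(n^ℓ)`) provably distinguishes planted from random; SOKB's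
Thm. 4.18 applies it with `κ = 0.99ρ`. [cite: SchmidhuberEtAl2025, Thm. 2.21 with Thm. 4.18 (κ = 0.99ρ)] -/
def thresholdDensity (k ℓ : ℕ) (κ : ℝ) (n : ℕ) : ℝ :=
  aliceConstant k κ (κ / (2 + κ)) n * ((n : ℝ) / ℓ) ^ (((k : ℝ) - 2) / 2)

/-- The Alice constant is positive for `κ, ε > 0` and `n ≥ 2`. [folklore] -/
theorem aliceConstant_pos {k : ℕ} {κ ε : ℝ} (hκ : 0 < κ) (hε : 0 < ε) {n : ℕ} (hn : 2 ≤ n) :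
    0 < aliceConstant k κ ε n := by
  unfold aliceConstant
  have h1 : 0 < Real.log n := Real.log_pos (by exact_mod_cast hn)
  have h3 : (0 : ℝ) < (k.choose (k / 2) : ℕ) := by exact_mod_cast Nat.choose_pos (Nat.div_le_self k 2)
  positivity

/-- The Kikuchi threshold density is positive for `κ > 0`, `ℓ ≥ 1` and `n ≥ 2`. [folklore] -/
theorem thresholdDensity_pos {k ℓ : ℕ} {κ : ℝ} (hκ : 0 < κ) (hℓ : 0 < ℓ) {n : ℕ} (hn : 2 ≤ n) :
    0 < thresholdDensity k ℓ κ n := by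
  unfold thresholdDensity
  have h1 : 0 < aliceConstant k κ (κ / (2 + κ)) n := aliceConstant_pos hκ (by positivity) hn
  have h2 : (0 : ℝ) < (n : ℝ) / ℓ := by
    have : (0 : ℝ) < n := by exact_mod_cast lt_of_lt_of_le (by norm_num) hn
    have : (0 : ℝ) < ℓ := by exact_mod_cast hℓ
    positivity
  positivity

/-- The Poisson mean `m̄ = Δ_ℓ(n) · n` of the number of constraints at the Kikuchi threshold
density (as an `ℝ≥0`; `Real.toNNReal`, which is the identity in the regime `n ≥ 2`, `κ > 0`).
[cite: SchmidhuberEtAl2025, Thm. 2.21 with Thm. 4.18] -/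
def thresholdMean (k ℓ : ℕ) (κ : ℝ) (n : ℕ) : ℝ≥0 :=
  (thresholdDensity k ℓ κ n * n).toNNReal

/-! ### The distinguishing problem on the word RAM (Problem 2.6, fine-grained) -/

/-- The probability that the program `M` (word-size factor `k'`, `t` steps) outputs `[1]`
("random") on an instance drawn from `𝓡̃_{n,k}(m̄)`. [cite: SchmidhuberEtAl2025, Problem 2.6] -/
def randomSuccess (k : ℕ) (m : ℝ≥0) (M : Program) (k' t n : ℕ) : ℝ :=
  avgSuccessProb (poissonRandom n k m) encode (fun _ => {[1]}) M k' t

/-- The probability that `M` outputs `[0]` ("planted") on an instance drawn from `𝓟̃^z_{n,k}(m̄, ρ)`.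
[cite: SchmidhuberEtAl2025, Problem 2.6] -/
def plantedSuccess (k : ℕ) (m : ℝ≥0) (ρ : ℝ) (z : Fin n → ℤˣ) (M : Program) (k' t : ℕ) : ℝ :=
  avgSuccessProb (poissonPlanted n k m ρ z) encode (fun _ => {[0]}) M k' t

/-- `DistinguishesFrom k m̄ ρ M k' T σ n₀`: the oracle-free randomised word-RAM program `M` SOLVES
the Planted Noisy `k`XOR problem at Poisson mean `m̄(n)` and planted advantage `ρ` with confidence
`σ` within `T n` steps from size `n₀` on — for every `n ≥ n₀` it outputs `[1]` with probability
`≥ σ` on `𝓡̃_{n,k}(m̄ n)` and, for EVERY secret `z`, `[0]` with probability `≥ σ` on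
`𝓟̃^z_{n,k}(m̄ n, ρ)` (probabilities over the instance and the coins; Problem 2.6 with its `1 - o(1)`
replaced by the explicit `σ`, time and machine made explicit on the word RAM of VVW ICM 2018 §2).
[cite: SchmidhuberEtAl2025, Problem 2.6] -/
def DistinguishesFrom (k : ℕ) (m : ℕ → ℝ≥0) (ρ : ℝ) (M : Program) (k' : ℕ) (T : ℕ → ℕ) (σ : ℝ)
    (n₀ : ℕ) : Prop :=
  M.IsOracleFree ∧ ∀ n, n₀ ≤ n →
    σ ≤ randomSuccess k (m n) M k' (T n) n ∧
      ∀ z : Fin n → ℤˣ, σ ≤ plantedSuccess k (m n) ρ z M k' (T n)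

/-- `RandDistinguishableInTimeO k m̄ ρ t σ`: SOME randomised word-RAM program solves the Planted
Noisy `k`XOR problem (mean `m̄(n)`, advantage `ρ`) with confidence `σ` in time `O(t(n))`, i.e.
within `⌊C · t n + C⌋₊` steps, from some size on (the tree's `FGProblem.RandInTimeO` convention,
average-case and two-sided). [cite: SchmidhuberEtAl2025, Problem 2.6; VVW ICM2018 §2 (conventions)] -/
def RandDistinguishableInTimeO (k : ℕ) (m : ℕ → ℝ≥0) (ρ : ℝ) (t : ℕ → ℝ) (σ : ℝ) : Prop :=
  ∃ (M : Program) (k' n₀ : ℕ) (C : ℝ), DistinguishesFrom k m ρ M k' (fun n => ⌊C * t n + C⌋₊) σ n₀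

/-- Confidence is monotone: solving with confidence `σ` solves with every `σ' ≤ σ`. [folklore] -/
theorem DistinguishesFrom.mono {k : ℕ} {m : ℕ → ℝ≥0} {ρ : ℝ} {M : Program} {k' : ℕ} {T : ℕ → ℕ}
    {σ σ' : ℝ} {n₀ : ℕ} (h : DistinguishesFrom k m ρ M k' T σ n₀) (hσ : σ' ≤ σ) :
    DistinguishesFrom k m ρ M k' T σ' n₀ :=
  ⟨h.1, fun n hn => ⟨hσ.trans (h.2 n hn).1, fun z => hσ.trans ((h.2 n hn).2 z)⟩⟩

/-- No program solves the problem with confidence exceeding `1`. [folklore] -/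
theorem not_distinguishesFrom_of_one_lt {k : ℕ} {m : ℕ → ℝ≥0} {ρ : ℝ} {M : Program} {k' : ℕ}
    {T : ℕ → ℕ} {σ : ℝ} (hσ : 1 < σ) {n₀ : ℕ} : ¬ DistinguishesFrom k m ρ M k' T σ n₀ :=
  fun h => (lt_of_le_of_lt (avgSuccessProb_le_one _ _ _ _ _ _) hσ).not_ge (h.2 n₀ le_rfl).1

/-- The random side of Problem 2.6 as a distributional fine-grained problem (`DistFGProblem`):
instances of all sizes `Σ n, Instance n k`, at size `n` the law `𝓡̃_{n,k}(m̄ n)`, accepted output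
`[1]`. [cite: SchmidhuberEtAl2025, Problem 2.6] -/
def randomProblem (k : ℕ) (m : ℕ → ℝ≥0) : DistFGProblem where
  Inst := Σ n, Instance n k
  encode I := encode I.2
  dist n := (poissonRandom n k (m n)).map (Sigma.mk n)
  Good _ := {[1]}

/-- The planted side of Problem 2.6 with a uniformly random secret, as a `DistFGProblem`: at size
`n` the law `poissonPlantedAvg n k (m̄ n) ρ`, accepted output `[0]`. [cite: SchmidhuberEtAl2025, Problem 2.6 and the remark following it] -/
def plantedAvgProblem (k : ℕ) (m : ℕ → ℝ≥0) (ρ : ℝ) : DistFGProblem where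
  Inst := Σ n, Instance n k
  encode I := encode I.2
  dist n := (poissonPlantedAvg n k (m n) ρ).map (Sigma.mk n)
  Good _ := {[0]}

/-! ### The Kikuchi-threshold hypothesis (OPEN) -/

/-- **The Kikuchi-threshold hypothesis `KH_{k,ρ}(α)`** (OPEN HYPOTHESIS — a `Prop` definition,
nothing is asserted; status: open, never to be "discharged"). For every `ε > 0` and all
sufficiently large Kikuchi levels `ℓ = c · k` (multiples of `k`), NO randomised word-RAM program
solves the Planted Noisy `k`XOR problem with planted advantage `ρ` at the Kikuchi threshold density
`Δ_ℓ(n) = thresholdDensity k ℓ (0.99ρ) n` (the density at which the level-`ℓ` Kikuchi method, time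
`Õ(n^ℓ)`, and SOKB's quantum algorithm, Thm. 4.18 with `κ = 0.99ρ`, apply) with confidence `2/3`
in time `O(n^{(α-ε)ℓ})`. `α = 1` says "the Kikuchi method is optimal up to `n^{o(ℓ)}`". Informal
source of the belief: SOKB §1.1 ("it would be a major algorithmic breakthrough if any classical
algorithm outperformed the SoS bound … the Kikuchi method is believed to be close to optimal (up to
the gap between the upper and lower bounds)"), the evidence being the degree-`ℓ` SoS lower bound of
Kothari–Mori–O'Donnell–Witmer 2017, which matches `Δ_ℓ` only up to factors polylogarithmic in the
density — at FIXED `ℓ` and `n → ∞` such factors are not resolved by that evidence (caveat for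
graders). The fine-grained form (word RAM, exponent `(α-ε)ℓ`, threshold `2/3`) is the consumer
route's (QuantumAdvantage/ExponentLadder). [cite: SchmidhuberEtAl2025, §1.1 (computational threshold; informal); KothariEtAl2017 (evidence)] -/
def KikuchiThreshold (k : ℕ) (ρ α : ℝ) : Prop :=
  ∀ ε : ℝ, 0 < ε → ∃ c₀ : ℕ, ∀ c : ℕ, c₀ ≤ c →
    ¬ RandDistinguishableInTimeO k (fun n => thresholdMean k (c * k) (0.99 * ρ) n) ρ
        (fun n => (n : ℝ) ^ ((α - ε) * (c * k : ℕ))) (2 / 3)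

/-- `KH` is antitone in the exponent: `KH(α)` implies `KH(α')` for `α' ≤ α`. [folklore] -/
theorem KikuchiThreshold.anti {k : ℕ} {ρ α α' : ℝ} (h : KikuchiThreshold k ρ α) (hα : α' ≤ α) :
    KikuchiThreshold k ρ α' := by
  intro ε hε
  obtain ⟨c₀, hc₀⟩ := h (ε + (α - α')) (by linarith)
  refine ⟨c₀, fun c hc => ?_⟩
  have : (fun n : ℕ => (n : ℝ) ^ ((α' - ε) * (c * k : ℕ))) =
      fun n : ℕ => (n : ℝ) ^ ((α - (ε + (α - α'))) * (c * k : ℕ)) := by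
    funext n; congr 1; ring
  rw [this]
  exact hc₀ c hc

/-! ### Quantum algorithms for Problem 2.6 and SOKB's Theorem 4.18 -/

/-- `HasQuantumSolver G k m̄ ρ gates qubits`: there is a quantum algorithm (`QCircuitAlg`, one per
size `n`, over the gate set `G`) whose circuits have, from some size on and for EVERY instance and
seed, at most `gates n` gates and `qubits n` qubits, and which solves Problem 2.6 at Poisson mean
`m̄(n)` and planted advantage `ρ` with probability `1 - o(1)` over the instance, the seed and the
measurement: for every `σ < 1`, from some size on it reports `1` with probability `≥ σ` on
`𝓡̃_{n,k}(m̄ n)` and `0` with probability `≥ σ` on `𝓟̃^z_{n,k}(m̄ n, ρ)` for every `z`. (Worst-case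
resource bounds; no uniformity is asserted — see `HasUniformQuantumSolver`.) [cite: SchmidhuberEtAl2025, Problem 2.6 and Thm. 4.18 (shape of the claim)] -/
def HasQuantumSolver (G : QGateSet) (k : ℕ) (m : ℕ → ℝ≥0) (ρ : ℝ) (gates qubits : ℕ → ℝ) : Prop :=
  ∃ A : (n : ℕ) → QCircuitAlg (Instance n k) G,
    (∃ n₀, ∀ n, n₀ ≤ n → ∀ (I : Instance n k) (r : Fin (A n).seeds → Bool),
        (((A n).circ I r).size : ℝ) ≤ gates n ∧ ((A n).width I r : ℝ) ≤ qubits n) ∧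
    ∀ σ : ℝ, σ < 1 → ∃ n₀, ∀ n, n₀ ≤ n →
        σ ≤ (A n).avgOutputOne (poissonRandom n k (m n)) ∧
        ∀ z : Fin n → ℤˣ, σ ≤ (A n).avgOutputZero (poissonPlanted n k (m n) ρ z)

/-- `HasUniformQuantumSolver G k m̄ ρ pre gates qubits`: the UNIFORM version — a single oracle-free
randomised word-RAM program `W` (word-size factor `k'`) which, from some size on, on the encoding of
EVERY instance and for EVERY coin vector writes within `⌊pre n⌋₊` steps the code (`circuitCode`) of
a circuit over `G` with at most `gates n` gates on at most `qubits n` qubits, such that running the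
written circuit on `|0…0⟩` and measuring wire `0` solves Problem 2.6 with probability `1 - o(1)`
over instance, coins and measurement (`transducerBornAvg`). This is the shape in which a consumer
can state SOKB's algorithm with an explicit classical preprocessing time (the paper prints
"efficient", Thm. 4.15); nothing is asserted here. [cite: SchmidhuberEtAl2025, Thm. 4.15 ("an efficient algorithm … produces a quantum circuit") and Thm. 4.18] -/
def HasUniformQuantumSolver (G : QGateSet) [Encodable G.Op] (k : ℕ) (m : ℕ → ℝ≥0) (ρ : ℝ)
    (pre gates qubits : ℕ → ℝ) : Prop :=
  ∃ (W : Program) (k' : ℕ), W.IsOracleFree ∧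
    (∃ n₀, ∀ n, n₀ ≤ n → ∀ I : Instance n k,
      ∀ ρc : Fin ⌊pre n⌋₊ → Fin (2 ^ (k' * inputWidth (encode I))),
        ∃ C : Σ q, QCircuit G q,
          OutputsWithin W (k' * inputWidth (encode I)) noOracle (coinStream ρc) (encode I)
            (circuitCode C) ⌊pre n⌋₊ ∧ (C.2.size : ℝ) ≤ gates n ∧ (C.1 : ℝ) ≤ qubits n) ∧
    ∀ σ : ℝ, σ < 1 → ∃ n₀, ∀ n, n₀ ≤ n →
      σ ≤ transducerBornAvg G (poissonRandom n k (m n)) encode W k' ⌊pre n⌋₊ true ∧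
      ∀ z : Fin n → ℤˣ,
        σ ≤ transducerBornAvg G (poissonPlanted n k (m n) ρ z) encode W k' ⌊pre n⌋₊ false

/-- **Schmidhuber–O'Donnell–Kothari–Babbush, Theorem 4.18 (quartic quantum speedup for Planted
Noisy `k`XOR), with the qubit count of §4 — NAMED FACT.** Printed statement (Thm. 4.18): "Let `k`
(an even number) and `ρ ∈ (0,1)` be constants. Let `𝓘̂` be drawn from `𝓟̃^z_{n,k}(m, ρ)` or
`𝓡̃_{n,k}(m)`. Suppose we have a 'reasonable' Alice Theorem (e.g. Thm. 2.21) that guarantees that when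
`𝓘 ∼ 𝓡̃_{n,k}(m)`, if `Δ = m/n ≥ C_κ (n/ℓ)^{(k-2)/2}`, then with probability `1 - o(1)` we have
`λ_max(𝓚_ℓ(𝓘)) ≤ κ d`. Let `ℓ = ck = O(√n)` for `c ∈ ℕ⁺` be chosen such that this holds with
`κ = 0.99ρ`. Then there is a quantum algorithm that uses `Õ(n^{ℓ/4} · m · ℓ^{O(ℓ)} · log^{ℓ/2k} n)`
gates to solve the Planted Noisy `k`XOR Problem (Problem 2.6)." Qubits (§1.3; Thm. 4.9: `A + O(N) +
Õ(log Q)`; Thm. 4.15; Thm. 4.17: `O(ℓ log n)`): `Õ(ℓ log n)`. Vendored SPECIAL CASE: the Alice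
Theorem is the paper's Thm. 2.21 (admissible `ε = κ/(2+κ)`), the Poisson mean is EXACTLY the
threshold `m̄ = Δ_ℓ(n) · n` (`thresholdMean k ℓ (0.99ρ)`), and the level `ℓ = ck` is FIXED while
`n → ∞`: for all even `k ≥ 2` and `ρ ∈ (0,1)` there are qubit constants `C_q, a_q` (uniform in `ℓ`)
such that for every `c ≥ 1`, with `ℓ = ck`, there are `C_g, a_g` and a quantum algorithm over
arbitrary one- and two-qubit gates (`twoLocal`) with at most `C_g · n^{ℓ/4} · m̄(n) · (ln n)^{a_g}`
gates and at most `C_q · (ℓ log₂ n) · (log₂(ℓ log₂ n))^{a_q}` qubits solving Problem 2.6 with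
probability `1 - o(1)` (`HasQuantumSolver`). No uniformity/preprocessing-time claim is part of
this fact (the paper: "efficient"). [cite: SchmidhuberEtAl2025, Thm. 4.18 with Thms. 2.21, 4.9, 4.15, 4.17 and §1.3] -/
def SchmidhuberEtAl2025_thm418 : Prop :=
  ∀ k : ℕ, Even k → 2 ≤ k → ∀ ρ : ℝ, 0 < ρ → ρ < 1 →
    ∃ Cq aq : ℕ, ∀ c : ℕ, 1 ≤ c → ∃ Cg ag : ℕ,
      HasQuantumSolver twoLocal k (fun n => thresholdMean k (c * k) (0.99 * ρ) n) ρ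
        (fun n => Cg * (n : ℝ) ^ (((c * k : ℕ) : ℝ) / 4) * thresholdMean k (c * k) (0.99 * ρ) n *
          Real.log n ^ ag)
        (fun n => Cq * ((c * k : ℕ) * Real.logb 2 n) * Real.logb 2 ((c * k : ℕ) * Real.logb 2 n) ^ aq)

end KXOR

end Literature.Computability.QuantumComplexity
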